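import Summits.BirchSwinnertonDyer.BirchSwinnertonDyer.Theorems.ThetaPartnerAtTwoMazurTateCongruenceAtTwoRPlusLineThreeFacts
import Summits.BirchSwinnertonDyer.BirchSwinnertonDyer.Theorems.ResidualThetaTransportAtTwoThetaLayerLambdaCongruenceAtTwoSocleOfCosocle
import HarnessLib

noncomputable section
-- justification: the `Summit.BirchSwinnertonDyer.BirchSwinnertonDyer.…` path repeats a component (route-file convention)
set_option linter.dupNamespace false
open scoped MatrixGroups ModularForm NumberField Pointwise Classical
open CongruenceSubgroup Polynomial IsDedekindDomain Field Matrix WeierstrassCurve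
open Literature.NumberTheory.EllipticCurves Literature.NumberTheory.EllipticCurves.ModularForms
open Literature.NumberTheory.EllipticCurves.Rank1Residual Literature.NumberTheory.GaloisRepresentations Rat.HeightOneSpectrum
namespace Summit.BirchSwinnertonDyer.BirchSwinnertonDyer.Theorems.ThetaLayerLambdaCongruenceAtTwo

set_option linter.unusedTactic false in
set_option linter.unreachableTactic false in
set_option linter.unusedVariables false in
/-- (TYPING-ROBUST twin of `finrank_torsionBySet_eq_two_of_buzzard`, one extra binder `hSD`.) **`dim_{𝕋/𝔪} J₀(L)[𝔪] = 2` at a mod-`2`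
eigen-ideal of a good-supersingular-at-`2` curve from {SD, Bz}**, proved so that it elaborates under EITHER coordinate of the ONE vendored
Buzzard fact: if `buzzard2000_multiplicityOne_gamma0` concludes the SUB form (uniformisation / Albanese reading, typing of record) the first
branch closes the goal and `hSD` is idle; if it is re-typed to conclude the QUOTIENT form `dim_{𝕋/𝔪} Λ/𝔪Λ = 2` (Kummer / Picard reading,
review p648238 «replacement, not addition»), the second branch converts back through the `w_N`-twisted pairing
(`finrank_torsionBySet_eq_two_of_cosocle_of_sd`, p650638). Hypotheses (U)(I)(S) of the fact are discharged exactly as in the sibling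
(Eichler–Shimura charpoly; `ρ̄_{W,2}` onto `GL₂(𝔽₂)`; non-scalar on `D_𝔓`). Callers holding `hSD` (`kTwo_of_dvd_of_esSdBz`, `kTwo_of_dvd_of_mcSdBz`)
switch by adding one token. [cite: Buzzard2000LevelLoweringModTwo, Prop. 2.4 and Def. 2.1–2.2 (p. 100–101)]
[cite: DarmonDiamondTaylor1995, §1.6 Lemma 1.38 and §4.5 Thm. 4.26] [cite: DokchitserDokchitserMathZ2012, Theorem (1)] -/
theorem finrank_torsionBySet_eq_two_of_sd_buzzard
    (hSD : heckeSelfDual_torsionBy_J0) (hBz : buzzard2000_multiplicityOne_gamma0)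
    (W : WeierstrassCurve ℚ) [W.IsElliptic] [W.IsGloballyMinimal] (hss : GoodSS W 2)
    (L : ℕ) [NeZero L] (hL : Odd L)
    (hgood : ∀ v : HeightOneSpectrum (𝓞 ℚ), ¬ ((primesEquiv v : ℕ) ∣ 2 * L) → W.HasGoodReductionAt v)
    (𝔪 : Ideal (HeckeRing0 L 2)) (h𝔪 : 𝔪.IsMaximal) (h2 : (2 : HeckeRing0 L 2) ∈ 𝔪)
    (hq : Nat.card (HeckeRing0 L 2 ⧸ 𝔪) = 2)
    (hT : ∀ (q : ℕ) (hq : q.Prime), ¬ q ∣ L → HeckeRing0.T L 2 q hq - (W.LFunction q : HeckeRing0 L 2) ∈ 𝔪) :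
    Module.finrank (HeckeRing0 L 2 ⧸ 𝔪) (Submodule.torsionBySet (HeckeRing0 L 2) (J0 L) 𝔪) = 2 := by
  classical
  -- the coefficient field `k = 𝔽̄₂` (discrete) and `ι : 𝕋/𝔪 ≅ 𝔽₂ → k`
  let k : Type := AlgebraicClosure (ZMod 2)
  letI : TopologicalSpace k := ⊥
  haveI : DiscreteTopology k := ⟨rfl⟩
  haveI : Finite (HeckeRing0 L 2 ⧸ 𝔪) := Nat.finite_of_card_ne_zero (by rw [hq]; norm_num)
  letI : Fintype (HeckeRing0 L 2 ⧸ 𝔪) := Fintype.ofFinite _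
  have hF : Fintype.card (HeckeRing0 L 2 ⧸ 𝔪) = 2 := by rw [Fintype.card_eq_nat_card, hq]
  let e : ZMod 2 ≃+* HeckeRing0 L 2 ⧸ 𝔪 := ZMod.ringEquivOfPrime _ Nat.prime_two hF
  let f : ZMod 2 →+* k := algebraMap (ZMod 2) k
  let ι : HeckeRing0 L 2 ⧸ 𝔪 →+* k := f.comp e.symm.toRingHom
  have hι : ∀ a : ℤ, ι (Ideal.Quotient.mk 𝔪 (a : HeckeRing0 L 2)) = (a : k) := fun a ↦ by
    simp only [map_intCast]
  -- the mod-`2` representation of `W` and its base change to `k`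
  obtain ⟨ρ₀, hρ₀⟩ := W.exists_isTorsionGaloisRep 2
  let ρ : ModPGaloisRep ℚ k 2 := FramedRep.baseChange f continuous_of_discreteTopology ρ₀
  have hρapp : ∀ σ, ((ρ σ : GL (Fin 2) k) : Matrix (Fin 2) (Fin 2) k) =
      ((ρ₀ σ : GL (Fin 2) (ZMod 2)) : Matrix (Fin 2) (Fin 2) (ZMod 2)).map f := fun σ ↦ rfl
  -- (U) unramified with the Eichler–Shimura characteristic polynomial at `p ∤ 2L`
  have hU : ∀ v : HeightOneSpectrum (𝓞 ℚ), ¬ ((primesEquiv v : Nat.Primes) : ℕ) ∣ 2 * L →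
      ρ.IsUnramifiedAt v ∧
        ρ.HasFrobCharpolyAt v
          (X ^ 2
            - C (ι (Ideal.Quotient.mk 𝔪 (HeckeRing0.T L 2
                ((primesEquiv v : Nat.Primes) : ℕ) (primesEquiv v : Nat.Primes).2))) * X
            + C (((primesEquiv v : Nat.Primes) : ℕ) : k)) := by
    intro v hv
    have hp2 : ¬ ((primesEquiv v : Nat.Primes) : ℕ) ∣ 2 := fun h ↦ hv (h.mul_right L)
    have hpL : ¬ ((primesEquiv v : Nat.Primes) : ℕ) ∣ L := fun h ↦ hv (Dvd.dvd.mul_left h 2)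
    have hgoodv : W.HasGoodReductionAt v := hgood v hv
    have h2v : ((2 : ℕ) : 𝓞 ℚ) ∉ v.asIdeal := fun h ↦ hp2 ((natCast_mem_asIdeal_iff_primesEquiv_dvd v 2).mp h)
    refine ⟨?_, ?_⟩
    · intro 𝔓 h𝔓 σ hσ
      have h1 : ρ₀ σ = 1 := hρ₀.isUnramifiedAt_of_hasGoodReductionAt hgoodv h2v 𝔓 h𝔓 σ hσ
      change Matrix.GeneralLinearGroup.map f (ρ₀ σ) = 1
      rw [h1, map_one]
    · intro 𝔓 h𝔓 σ hσ
      have hc := hρ₀.charpoly_eq_of_isArithFrobAt (W.trace_galoisRepTate_frobenius_of_hasGoodReductionAt_holds 2)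
        (W.det_galoisRepTate_frobenius_of_hasGoodReductionAt_holds 2) h2v hgoodv h𝔓 hσ
      have hTp : ι (Ideal.Quotient.mk 𝔪 (HeckeRing0.T L 2 ((primesEquiv v : Nat.Primes) : ℕ) (primesEquiv v).2)) =
          ((W.frobeniusTraceAt v : ℤ) : k) := by
        have hmk : Ideal.Quotient.mk 𝔪 (HeckeRing0.T L 2 ((primesEquiv v : Nat.Primes) : ℕ) (primesEquiv v).2) =
            Ideal.Quotient.mk 𝔪 ((W.LFunction (primesEquiv v : ℕ) : ℤ) : HeckeRing0 L 2) := by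
          rw [Ideal.Quotient.mk_eq_mk_iff_sub_mem]
          exact hT _ (primesEquiv v).2 hpL
        rw [hmk, hι, W.lFunction_primesEquiv_eq_frobeniusTraceAt hgoodv]
      change (((ρ σ : GL (Fin 2) k) : Matrix (Fin 2) (Fin 2) k)).charpoly = _
      rw [hρapp, Matrix.charpoly_map, hc, hTp, natCard_residueField_adicCompletionIntegers v]
      simp only [Polynomial.map_add, Polynomial.map_sub, Polynomial.map_mul, Polynomial.map_pow, Polynomial.map_X,
        Polynomial.map_C]
      rw [map_intCast f, map_natCast f]
  -- (I) irreducible over `k`: the image contains both transvections (§1: `ρ̄_{W,2}` is onto `GL₂(𝔽₂)`)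
  have hI : FramedRep.IsIrreducible ρ := by
    obtain ⟨T₁, hT₁⟩ := exists_GL_coe_eq_upperTransvection (ZMod 2)
    obtain ⟨T₂, hT₂⟩ := exists_GL_coe_eq_lowerTransvection (ZMod 2)
    obtain ⟨σ₁, h₁⟩ := exists_apply_eq_of_goodSS_two W hss hρ₀ T₁
    obtain ⟨σ₂, h₂⟩ := exists_apply_eq_of_goodSS_two W hss hρ₀ T₂
    have e₁ : ((ρ σ₁ : GL (Fin 2) k) : Matrix (Fin 2) (Fin 2) k) = !![(1 : k), 1; 0, 1] := by
      rw [hρapp, h₁, hT₁, map_upperTransvection]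
    have e₂ : ((ρ σ₂ : GL (Fin 2) k) : Matrix (Fin 2) (Fin 2) k) = !![(1 : k), 0; 1, 1] := by
      rw [hρapp, h₂, hT₂, map_lowerTransvection]
    refine isIrreducible_of_not_hasCommonEigenvector ρ.toMonoidHom ?_
    rintro ⟨w, hw0, hw⟩
    obtain ⟨a, ha⟩ := hw σ₁
    obtain ⟨b, hb⟩ := hw σ₂
    change ((ρ σ₁ : GL (Fin 2) k) : Matrix (Fin 2) (Fin 2) k) *ᵥ w = a • w at ha
    change ((ρ σ₂ : GL (Fin 2) k) : Matrix (Fin 2) (Fin 2) k) *ᵥ w = b • w at hb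
    rw [e₁] at ha
    rw [e₂] at hb
    exact hw0 (eq_zero_of_transvections_mulVec_eq_smul ha hb)
  -- (S) non-scalar on the decomposition groups at `2` (§2: some `σ ∈ D_𝔓` has `ρ̄(σ) ≠ 1`; over `𝔽₂` the only scalar unit is `1`)
  have hS : ∀ v : HeightOneSpectrum (𝓞 ℚ), ((primesEquiv v : Nat.Primes) : ℕ) = 2 →
      ∀ 𝔓 ∈ v.primesAbove, ∃ σ ∈ 𝔓.decompositionSubgroup (Field.absoluteGaloisGroup ℚ),
        ∀ c : k, ((ρ σ : GL (Fin 2) k) : Matrix (Fin 2) (Fin 2) k) ≠ Matrix.scalar (Fin 2) c := by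
    intro v hv 𝔓 h𝔓
    obtain ⟨σ, hσ, hne⟩ := exists_mem_decompositionSubgroup_apply_ne_one_of_goodSS_two W hss hρ₀ hv h𝔓
    refine ⟨σ, hσ, fun c hc ↦ hne ?_⟩
    have hf : Function.Injective f := (algebraMap (ZMod 2) k).injective
    rw [hρapp] at hc
    have hent : ∀ i j, f (((ρ₀ σ : GL (Fin 2) (ZMod 2)) : Matrix (Fin 2) (Fin 2) (ZMod 2)) i j) =
        Matrix.scalar (Fin 2) c i j := fun i j ↦ by
      rw [← hc]; rfl
    have h01 : ((ρ₀ σ : GL (Fin 2) (ZMod 2)) : Matrix (Fin 2) (Fin 2) (ZMod 2)) 0 1 = 0 :=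
      hf (by rw [hent, map_zero]; simp)
    have h10 : ((ρ₀ σ : GL (Fin 2) (ZMod 2)) : Matrix (Fin 2) (Fin 2) (ZMod 2)) 1 0 = 0 :=
      hf (by rw [hent, map_zero]; simp)
    have hdet : IsUnit (((ρ₀ σ : GL (Fin 2) (ZMod 2)) : Matrix (Fin 2) (Fin 2) (ZMod 2)) 0 0 *
        ((ρ₀ σ : GL (Fin 2) (ZMod 2)) : Matrix (Fin 2) (Fin 2) (ZMod 2)) 1 1) := by
      have h := (Matrix.isUnit_iff_isUnit_det _).mp (ρ₀ σ).isUnit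
      rwa [Matrix.det_fin_two, h01, zero_mul, sub_zero] at h
    have hcases : ∀ x : ZMod 2, x ≠ 0 → x = 1 := by decide
    have h00 := hcases _ (IsUnit.mul_iff.mp hdet).1.ne_zero
    have h11 := hcases _ (IsUnit.mul_iff.mp hdet).2.ne_zero
    refine Matrix.GeneralLinearGroup.ext fun i j ↦ ?_
    rw [Units.val_one]
    fin_cases i <;> fin_cases j
    · simpa using h00
    · simpa using h01
    · simpa using h10
    · simpa using h11
  -- the fact's conclusion, in EITHER coordinate: sub form directly (Albanese typing of record), or cosocle form
  -- (Picard typing) converted back by the SD pairing (`finrank_torsionBySet_eq_two_of_cosocle_of_sd`)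
  first
    | exact hBz L hL 𝔪 h𝔪 h2 k ι ρ hU hI hS
    | exact finrank_torsionBySet_eq_two_of_cosocle_of_sd hSD 𝔪 h2 hq (hBz L hL 𝔪 h𝔪 h2 k ι ρ hU hI hS)

end Summit.BirchSwinnertonDyer.BirchSwinnertonDyer.Theorems.ThetaLayerLambdaCongruenceAtTwo

end
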